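import Mathlib
import HarnessLib
import Summits.Ventures.LatticeQCDFlow.Scoring.KArmHomogeneityGaussian
import Summits.Ventures.LatticeQCDFlow.Scoring.IndependentFamilyJointLimit
import Summits.Ventures.LatticeQCDFlow.Scoring.AsymptoticCoverage

/-!
# THE `k`-ARM HOMOGENEITY TEST IS CALIBRATED: FOR `R ≥ 2` INDEPENDENT CODES WITH CONSISTENT ERROR
# BARS, `P(Σ_r (Sₙ^r − m̂ₙ)²/V̂ₙ^r ≤ c) → N(0,1)^{⊗R}{Σ_{r≠0} z_r² ≤ c}` (textbook: `P(χ²_{R−1} ≤ c)`)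

HONEST FRAMING: exact (Metropolis-corrected) sampling algorithms for lattice gauge theory;
figures of merit are autocorrelation/cost numbers at stated couplings and volumes; no
continuum-physics claim.

Venture `LatticeQCDFlow` (cell pub-lqcd), topic `Scoring`; FANOUT row 4 (`s0-u1-b`, GEN-33).
NEW WORK of the cell (classical), no definition, nothing cited as a fact (Cochran's `χ²`
homogeneity test NAMED ONLY).

WHY (row 4).  The cell validates ONE sampler through SEVERAL independent implementations (S0 arms
A, B, C; "two implementations before reproduced").  Pairwise `σ_comb` tests are calibrated in the
tree (`Scoring/TwoCodeAgreement*`); the one-shot inverse-variance homogeneity statistic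
`Qₙ = Σ_r (Sₙ^r − m̂ₙ)²/V̂ₙ^r`, `m̂ₙ = (Σ_r Sₙ^r/V̂ₙ^r)/(Σ_r 1/V̂ₙ^r)`, compares all `R` printed columns
at once.  THE THEOREM: if each code `r` prints an estimate `Sₙ^r` with `√n(Sₙ^r − a) ⇒ N(0, s_r)`
(the SAME centre `a`) and a squared error bar with `n·V̂ₙ^r → s_r > 0` almost surely, then on the
product space `⊗_r P_r` (independent codes) `P(Qₙ ≤ c) → N(0,1)^{⊗R}{z | Σ_{r≠0} z_r² ≤ c}` for
every `c` — the nominal `χ²_{R−1}` calibration, as a Gaussian functional (Mathlib has no `χ²` law).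
Proof: joint CLT of the `R` independent columns (`Scoring/IndependentFamilyJointLimit`), Slutsky
with the error-bar vector (Mathlib), the exact scale identity `Qₙ = G(√n(S − a), nV̂)` eventually
almost surely (eventual-agreement device, `tendstoInDistribution_of_tendstoInMeasure_sub`),
portmanteau on the continuity set `{· ≤ c}` and the law of the limit
(`Scoring/KArmHomogeneityGaussian`, `Scoring/GaussianCochranReduction`).

## Content

* `homogeneity_statistic_scale` (§1) — `Σ_r (x_r − m̂)²/v_r = Σ_r (√n(x_r − a) − M)²/(n v_r)`,
  `M` the inverse-variance mean of the scaled columns (`n ≥ 1`, `v_r > 0`).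
* `continuous_homogeneityClamp` (§1) — the clamped functional
  `G(y, v) = Σ_r (y_r − M(y, v ∨ m₀))²/(v_r ∨ m₀)` is continuous on
  `EuclideanSpace ℝ (Fin R) × EuclideanSpace ℝ (Fin R)` (`m₀ > 0`).
* **`kArm_homogeneity_coverage`** (§2) — THE THEOREM (`R = n + 2 ≥ 2` codes).

NOT CLAIMED: different centres (power); unequal sample sizes per code (same proof along `m_r(n)`);
dependent codes; anything numerical.
-/

open MeasureTheory ProbabilityTheory Filter Topology Finset

namespace Summit.Ventures.LatticeQCDFlow.Scoring

open Set WithLp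

/-! ## §1 Algebra and the clamped functional -/

section Algebra

variable {R : ℕ}

/-- **Scale identity**: for `n ≥ 1` and `v_r > 0`,
`Σ_r (x_r − m̂)²/v_r = Σ_r (√n(x_r − a) − M)²/(n·v_r)` with `m̂ = (Σ_j x_j/v_j)/(Σ_j v_j⁻¹)` and
`M = (Σ_j √n(x_j − a)/(n v_j))/(Σ_j (n v_j)⁻¹)` (`= √n(m̂ − a)`). [ours] -/
theorem homogeneity_statistic_scale [NeZero R] {n : ℕ} (hn : 1 ≤ n) (x v : Fin R → ℝ)
    (hv : ∀ r, 0 < v r) (a : ℝ) :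
    ∑ r, (x r - (∑ j, x j / v j) / (∑ j, (v j)⁻¹)) ^ 2 / v r
      = ∑ r, (Real.sqrt n * (x r - a)
          - (∑ j, Real.sqrt n * (x j - a) / ((n : ℝ) * v j)) / (∑ j, ((n : ℝ) * v j)⁻¹)) ^ 2
          / ((n : ℝ) * v r) := by
  have hn0 : (0 : ℝ) < n := by exact_mod_cast hn
  have hsn : 0 < Real.sqrt n := Real.sqrt_pos.2 hn0
  set W := ∑ j, (v j)⁻¹ with hW
  have hW0 : 0 < W := Finset.sum_pos (fun j _ => inv_pos.2 (hv j)) Finset.univ_nonempty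
  set T := ∑ j, x j / v j with hT
  have hM : (∑ j, Real.sqrt n * (x j - a) / ((n : ℝ) * v j)) / (∑ j, ((n : ℝ) * v j)⁻¹)
      = Real.sqrt n * (T / W - a) := by
    have h1 : ∑ j, Real.sqrt n * (x j - a) / ((n : ℝ) * v j)
        = Real.sqrt n / n * (T - a * W) := by
      rw [hT, hW, mul_sub, Finset.mul_sum, Finset.mul_sum, Finset.mul_sum, ← Finset.sum_sub_distrib]
      refine Finset.sum_congr rfl fun j _ => ?_
      have := (hv j).ne'
      field_simp
    have h2 : ∑ j, ((n : ℝ) * v j)⁻¹ = W / n := by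
      rw [hW, Finset.sum_div]
      refine Finset.sum_congr rfl fun j _ => ?_
      have := (hv j).ne'
      field_simp
    rw [h1, h2]
    field_simp
  rw [hM]
  refine Finset.sum_congr rfl fun r _ => ?_
  have hvr := (hv r).ne'
  have e : Real.sqrt n * (x r - a) - Real.sqrt n * (T / W - a) = Real.sqrt n * (x r - T / W) := by ring
  rw [e, mul_pow, Real.sq_sqrt hn0.le]
  field_simp

/-- The clamped homogeneity functional is continuous on `EuclideanSpace ℝ (Fin R) × (Fin R → ℝ)`
for every clamp `m₀ > 0`. [ours] -/
theorem continuous_homogeneityClamp [NeZero R] {m₀ : ℝ} (hm : 0 < m₀) :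
    Continuous fun p : EuclideanSpace ℝ (Fin R) × EuclideanSpace ℝ (Fin R) =>
      ∑ r, (p.1 r - (∑ j, p.1 j / max (p.2 j) m₀) / (∑ j, (max (p.2 j) m₀)⁻¹)) ^ 2
        / max (p.2 r) m₀ := by
  have hc1 : ∀ r : Fin R, Continuous fun p : EuclideanSpace ℝ (Fin R) × EuclideanSpace ℝ (Fin R) => p.1 r :=
    fun r => (PiLp.continuous_apply 2 _ r).comp continuous_fst
  have hc2 : ∀ r : Fin R, Continuous fun p : EuclideanSpace ℝ (Fin R) × EuclideanSpace ℝ (Fin R) =>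
      max (p.2 r) m₀ :=
    fun r => ((PiLp.continuous_apply 2 _ r).comp continuous_snd).max continuous_const
  have hpos : ∀ (p : EuclideanSpace ℝ (Fin R) × EuclideanSpace ℝ (Fin R)) (r : Fin R), 0 < max (p.2 r) m₀ :=
    fun p r => lt_max_of_lt_right hm
  have hden : Continuous fun p : EuclideanSpace ℝ (Fin R) × EuclideanSpace ℝ (Fin R) =>
      ∑ j, (max (p.2 j) m₀)⁻¹ :=
    continuous_finsetSum _ fun j _ => (hc2 j).inv₀ fun p => (hpos p j).ne'
  have hden0 : ∀ p : EuclideanSpace ℝ (Fin R) × EuclideanSpace ℝ (Fin R), (∑ j, (max (p.2 j) m₀)⁻¹) ≠ 0 :=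
    fun p => (Finset.sum_pos (fun j _ => inv_pos.2 (hpos p j)) Finset.univ_nonempty).ne'
  have hM : Continuous fun p : EuclideanSpace ℝ (Fin R) × EuclideanSpace ℝ (Fin R) =>
      (∑ j, p.1 j / max (p.2 j) m₀) / (∑ j, (max (p.2 j) m₀)⁻¹) :=
    (continuous_finsetSum _ fun j _ => (hc1 j).div (hc2 j) fun p => (hpos p j).ne').div hden hden0
  exact continuous_finsetSum _ fun r _ =>
    (((hc1 r).sub hM).pow 2).div (hc2 r) fun p => (hpos p r).ne'

end Algebra

/-! ## §2 The theorem -/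

section Coverage

variable {n : ℕ} {Ωs : Fin (n + 2) → Type*} [∀ r, MeasurableSpace (Ωs r)]
  {Ps : (r : Fin (n + 2)) → Measure (Ωs r)} [∀ r, IsProbabilityMeasure (Ps r)]
variable {Ω' : Type*} [MeasurableSpace Ω'] {P' : Measure Ω'} [IsProbabilityMeasure P']

set_option maxHeartbeats 400000 in
/-- **THE `k`-ARM HOMOGENEITY TEST IS CALIBRATED.**  `R = n + 2 ≥ 2` codes, code `r` printing on
its own probability space an estimate `Sₖ^r` (measurable) and a squared error bar `V̂ₖ^r`
(measurable) with `√k(Sₖ^r − a) ⇒ Z_r ∼ N(0, s_r)`, `s_r > 0`, the SAME centre `a`, and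
`k·V̂ₖ^r → s_r` almost surely; `(Z_r)_r` independent.  Then on the product space `⊗_r P_r`, for every
`c`, the probability that the inverse-variance homogeneity statistic is at most `c` tends to
`N(0,1)^{⊗R}{z | Σ_{r≠0} z_r² ≤ c}`. [ours] -/
theorem kArm_homogeneity_coverage {S V : (r : Fin (n + 2)) → ℕ → Ωs r → ℝ} {a : ℝ}
    {s : Fin (n + 2) → ℝ} {Z : Fin (n + 2) → Ω' → ℝ} (hs : ∀ r, 0 < s r)
    (hSm : ∀ r k, Measurable (S r k)) (hVm : ∀ r k, Measurable (V r k))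
    (hclt : ∀ r, TendstoInDistribution (fun (k : ℕ) ω => Real.sqrt k * (S r k ω - a)) atTop (Z r)
      (fun _ => Ps r) P')
    (hZm : ∀ r, Measurable (Z r)) (hZ : ∀ r, HasLaw (Z r) (gaussianReal 0 (s r).toNNReal) P')
    (hind : iIndepFun Z P')
    (hV : ∀ r, ∀ᵐ ω ∂(Ps r), Tendsto (fun k : ℕ => (k : ℝ) * V r k ω) atTop (𝓝 (s r))) (c : ℝ) :
    Tendsto (fun k : ℕ => (Measure.pi Ps).real {ω : (r : Fin (n + 2)) → Ωs r |
        ∑ r, (S r k (ω r) - (∑ j, S j k (ω j) / V j k (ω j)) / (∑ j, (V j k (ω j))⁻¹)) ^ 2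
          / V r k (ω r) ≤ c})
      atTop (𝓝 ((Measure.pi fun _ : Fin (n + 2) => gaussianReal 0 1).real
        {z : Fin (n + 2) → ℝ | ∑ r ∈ univ.erase 0, z r ^ 2 ≤ c})) := by
  -- the clamp
  set m₀ : ℝ := (Finset.univ.inf' Finset.univ_nonempty s) / 2 with hm₀
  have hinf : 0 < Finset.univ.inf' Finset.univ_nonempty s :=
    (Finset.lt_inf'_iff _).2 fun r _ => hs r
  have hm0 : 0 < m₀ := by rw [hm₀]; exact half_pos hinf
  have hm_le : ∀ r, m₀ < s r := fun r => by
    have : Finset.univ.inf' Finset.univ_nonempty s ≤ s r := Finset.inf'_le _ (Finset.mem_univ r)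
    rw [hm₀]; linarith
  -- Step 1: joint convergence of the scaled columns and of the error-bar vector
  have hXm : ∀ r (k : ℕ), Measurable fun ω : Ωs r => Real.sqrt (k : ℝ) * (S r k ω - a) :=
    fun r k => ((hSm r k).sub_const a).const_mul _
  have hY := CardConsistency.tendstoInDistribution_replicas (Ps := Ps) hclt hXm hZm hind
  have hWm : ∀ k : ℕ, Measurable fun (ω : (r : Fin (n + 2)) → Ωs r) (r : Fin (n + 2)) =>
      ((k : ℕ) : ℝ) * V r k (ω r) :=
    fun k => measurable_pi_lambda _ fun r => ((hVm r k).comp (measurable_pi_apply r)).const_mul _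
  have hae : ∀ᵐ ω ∂(Measure.pi Ps), ∀ r, Tendsto (fun k : ℕ => (k : ℝ) * V r k (ω r)) atTop (𝓝 (s r)) := by
    rw [ae_all_iff]
    intro r
    exact (Measure.quasiMeasurePreserving_eval Ps r).ae (hV r)
  have hWm' : ∀ k : ℕ, Measurable fun (ω : (r : Fin (n + 2)) → Ωs r) =>
      (toLp 2 (fun r : Fin (n + 2) => ((k : ℕ) : ℝ) * V r k (ω r)) : EuclideanSpace ℝ (Fin (n + 2))) :=
    fun k => (WithLp.measurable_toLp 2 _).comp (hWm k)
  have hW : TendstoInMeasure (Measure.pi Ps) (fun (k : ℕ) (ω : (r : Fin (n + 2)) → Ωs r) =>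
      (toLp 2 (fun r : Fin (n + 2) => ((k : ℕ) : ℝ) * V r k (ω r)) : EuclideanSpace ℝ (Fin (n + 2))))
      atTop (fun _ => (toLp 2 s : EuclideanSpace ℝ (Fin (n + 2)))) := by
    refine tendstoInMeasure_of_tendsto_ae (fun k => (hWm' k).aestronglyMeasurable) ?_
    filter_upwards [hae] with ω hω
    exact ((PiLp.continuous_toLp 2 (fun _ : Fin (n + 2) => ℝ)).tendsto s).comp (tendsto_pi_nhds.2 hω)
  -- Step 2: Slutsky with the clamped functional `F`
  set F : EuclideanSpace ℝ (Fin (n + 2)) × EuclideanSpace ℝ (Fin (n + 2)) → ℝ := fun p =>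
    ∑ r, (p.1 r - (∑ j, p.1 j / max (p.2 j) m₀) / (∑ j, (max (p.2 j) m₀)⁻¹)) ^ 2 / max (p.2 r) m₀
    with hF
  have hgc : Continuous F := continuous_homogeneityClamp (R := n + 2) hm0
  have hsl := hY.continuous_comp_prodMk_of_tendstoInMeasure_const hgc hW (fun k => (hWm' k).aemeasurable)
  -- the limit of the clamped functional is the unclamped limit statistic
  have hlim : (fun ω' => F ((toLp 2 fun r => Z r ω' : EuclideanSpace ℝ (Fin (n + 2))),
        (toLp 2 s : EuclideanSpace ℝ (Fin (n + 2)))))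
      = fun ω' => ∑ r, (Z r ω' - (∑ j, Z j ω' / s j) / (∑ j, (s j)⁻¹)) ^ 2 / s r := by
    funext ω'
    simp only [hF, max_eq_left (hm_le _).le]
  rw [hlim] at hsl
  -- Step 3: the printed statistic agrees with the clamped functional eventually, almost surely
  have hQm : ∀ k : ℕ, Measurable fun ω : (r : Fin (n + 2)) → Ωs r =>
      ∑ r, (S r k (ω r) - (∑ j, S j k (ω j) / V j k (ω j)) / (∑ j, (V j k (ω j))⁻¹)) ^ 2
        / V r k (ω r) := by
    intro k
    have h1 : ∀ r, Measurable fun ω : (r : Fin (n + 2)) → Ωs r => S r k (ω r) :=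
      fun r => (hSm r k).comp (measurable_pi_apply r)
    have h2 : ∀ r, Measurable fun ω : (r : Fin (n + 2)) → Ωs r => V r k (ω r) :=
      fun r => (hVm r k).comp (measurable_pi_apply r)
    fun_prop
  have hPm : ∀ k : ℕ, Measurable fun ω : (r : Fin (n + 2)) → Ωs r =>
      ((toLp 2 fun r => Real.sqrt (k : ℝ) * (S r k (ω r) - a) : EuclideanSpace ℝ (Fin (n + 2))),
        (toLp 2 (fun r : Fin (n + 2) => ((k : ℕ) : ℝ) * V r k (ω r)) : EuclideanSpace ℝ (Fin (n + 2)))) :=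
    fun k => ((WithLp.measurable_toLp 2 _).comp (measurable_pi_lambda _ fun r =>
      (hXm r k).comp (measurable_pi_apply r))).prodMk (hWm' k)
  have hdev : TendstoInMeasure (Measure.pi Ps) ((fun (k : ℕ) (ω : (r : Fin (n + 2)) → Ωs r) =>
      ∑ r, (S r k (ω r) - (∑ j, S j k (ω j) / V j k (ω j)) / (∑ j, (V j k (ω j))⁻¹)) ^ 2
        / V r k (ω r)) - fun (k : ℕ) ω =>
      F ((toLp 2 fun r => Real.sqrt (k : ℝ) * (S r k (ω r) - a) : EuclideanSpace ℝ (Fin (n + 2))),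
        (toLp 2 (fun r : Fin (n + 2) => ((k : ℕ) : ℝ) * V r k (ω r)) : EuclideanSpace ℝ (Fin (n + 2)))))
      atTop 0 := by
    refine tendstoInMeasure_of_tendsto_ae
      (fun k => ((hQm k).sub (hgc.measurable.comp (hPm k))).aestronglyMeasurable) ?_
    filter_upwards [hae] with ω hω
    have hev : ∀ᶠ k : ℕ in atTop, ∀ r, m₀ < ((k : ℕ) : ℝ) * V r k (ω r) :=
      eventually_all.2 fun r => (hω r).eventually_const_lt (hm_le r)
    refine (tendsto_const_nhds (x := (0 : ℝ))).congr' ?_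
    filter_upwards [hev, eventually_ge_atTop 1] with k hk hk1
    have hkpos : (0 : ℝ) < k := by exact_mod_cast hk1
    have hVpos : ∀ r, 0 < V r k (ω r) := fun r => by
      have := hk r
      nlinarith [hm0]
    simp only [Pi.sub_apply, hF, max_eq_left (hk _).le]
    rw [homogeneity_statistic_scale hk1 (fun r => S r k (ω r)) (fun r => V r k (ω r)) hVpos a]
    ring
  have hQ := tendstoInDistribution_of_tendstoInMeasure_sub _ _ hsl hdev (fun k => (hQm k).aemeasurable)
  -- Step 4: portmanteau on the continuity set `{· ≤ c}`
  have hLm : Measurable fun ω' => ∑ r, (Z r ω' - (∑ j, Z j ω' / s j) / (∑ j, (s j)⁻¹)) ^ 2 / s r := by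
    fun_prop
  have hfr : (P'.map fun ω' => ∑ r, (Z r ω' - (∑ j, Z j ω' / s j) / (∑ j, (s j)⁻¹)) ^ 2 / s r)
      (frontier (Iic c)) = 0 := by
    rw [frontier_Iic, Measure.map_apply hLm (measurableSet_singleton c)]
    exact measure_homogeneity_limit_levelSet_eq_zero hs hZm hZ hind c
  have hconv := CardConsistency.tendsto_measureReal_preimage_of_tendstoInDistribution hQ
    measurableSet_Iic hfr
  have hlimit : P'.real ((fun ω' => ∑ r, (Z r ω' - (∑ j, Z j ω' / s j) / (∑ j, (s j)⁻¹)) ^ 2 / s r)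
        ⁻¹' Iic c)
      = (Measure.pi fun _ : Fin (n + 2) => gaussianReal 0 1).real
        {z : Fin (n + 2) → ℝ | ∑ r ∈ univ.erase 0, z r ^ 2 ≤ c} := by
    simp only [measureReal_def]
    congr 1
    exact measure_homogeneity_limit_preimage_eq hs hZm hZ hind measurableSet_Iic
  rw [hlimit] at hconv
  exact hconv

end Coverage

end Summit.Ventures.LatticeQCDFlow.Scoring
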